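import Literature.Geometry.Riemannian.ThreeShrinkerDegenerateModelData
import Literature.Geometry.Riemannian.ThreeShrinkerScalarFlatCase
import Literature.Geometry.Riemannian.ThreeShrinkerCompactDegenerate
import Literature.Geometry.Riemannian.ShrinkerScalarCurvatureNonnegHolds
import HarnessLib

/-!
# Classification of three-dimensional shrinkers: assembly modulo the curvature inputs

The named fact `threeShrinkerClassification_modelData` (`ThreeShrinkerClassification.lean`,
Munteanu–Wang 2016, Thm. 1.2) asserts for every complete connected normalised three-dimensional
gradient shrinking Ricci soliton the model data of `ℝ³`, `S³/Γ`, `S²×ℝ` or `(S²×ℝ)/ℤ₂`. The tree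
proves:

* `R ≥ 0` (`shrinkerScalarCurvature_nonneg_holds`, Zhang 2009) and the dichotomy "`R > 0`
  everywhere or the Gaussian model data" (`ThreeShrinker.scalarCurvature_pos_or_modelData`);
* the compact case (`ThreeShrinker.modelData_of_compactSpace`);
* the degenerate case "`Ric ≥ 0`, `R > 0` and a null vector of `Ric`" ⇒ cylinder data
  (`DegenerateShrinker.modelData_of_degenerate`, this series of files).

What is not in the tree are the two curvature inputs of the published proof for the remaining
case (noncompact, `R > 0`): **(F1)** `Ric ≥ 0` — B.-L. Chen, *Strong uniqueness of the Ricci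
flow*, J. Differential Geom. 82 (2009), Cor. 2.4 (complete three-dimensional ancient solutions,
in particular shrinkers, have `sect ≥ 0`); **(F2)** a null vector of `Ric` exists — the
contrapositive of "a complete three-dimensional shrinker with `sect ≥ 0` and `Ric > 0` is
compact" (Perelman; O. Munteanu, J. Wang, *Positively curved shrinking Ricci solitons are
compact*, J. Differential Geom. 106 (2017), Thm. 2; L. Ni, N. Wallach 2008). This file records the
assembly **with (F1), (F2) as explicit hypotheses on the given soliton**
(`ThreeShrinker.modelData_of_curvature_inputs`); it is *not* a discharge of the named fact.

## References

* O. Munteanu, J. Wang, arXiv:1606.01861, Thm. 1.2 (p. 3). [MunteanuWang2016]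
* B.-L. Chen, J. Differential Geom. 82 (2009), Cor. 2.4. [Chen2009]
* O. Munteanu, J. Wang, J. Differential Geom. 106 (2017) = arXiv:1504.07898, Thm. 2.
  [MunteanuWang2017]
-/

noncomputable section

open Bundle Set Function Filter Module Metric MeasureTheory
open scoped Manifold ContDiff Topology NNReal ENNReal

namespace Literature.Geometry.Riemannian

open Lorentzian Lorentzian.PseudoRiemannianMetric

namespace ThreeShrinker

/-- **Munteanu–Wang 2016, Thm. 1.2, modulo the curvature inputs (F1), (F2)**: for a complete
connected normalised three-dimensional gradient shrinker, if in the noncompact case with `R > 0`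
one knows `Ric ≥ 0` (F1, Chen 2009, Cor. 2.4) and the existence of a null vector of `Ric`
(F2, Munteanu–Wang 2017, Thm. 2, contrapositive), then the model data of
`threeShrinkerClassification_modelData` hold. [cite: MunteanuWang2016, Thm. 1.2 (p. 3)]
[cite: Chen2009, Cor. 2.4] [cite: MunteanuWang2017, Thm. 2] -/
theorem modelData_of_curvature_inputs (N : Type) [TopologicalSpace N] [T2Space N]
    [SecondCountableTopology N] [ChartedSpace (EuclideanSpace ℝ (Fin 3)) N] [IsManifold (𝓡 3) ∞ N]
    [ConnectedSpace N] [T3Space N] [MeasurableSpace N] [BorelSpace N]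
    (h : PseudoRiemannianMetric (𝓡 3) ∞ (EuclideanSpace ℝ (Fin 3))
      (TangentSpace (𝓡 3) : N → Type _)) [h.HasLeviCivita] (φ : N → ℝ) (hh : h.IsRiemannian)
    (hcpl : ∀ (x : N) (r : ℝ≥0), IsCompact {y : N | h.edist hh x y ≤ r})
    (hφ : ContMDiff (𝓡 3) 𝓘(ℝ, ℝ) ∞ φ)
    (hsol : ∀ (x : N) (X Y : TangentSpace (𝓡 3) x),
      h.ricci x X Y + h.hessian φ x X Y = (1 / 2 : ℝ) * h.val x X Y)
    (hnorm : ∀ x : N, h.scalarCurvature x + h.gradSq φ x = φ x)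
    (hF1 : NoncompactSpace N → (∀ x : N, 0 < h.scalarCurvature x) →
      ∀ (x : N) (w : TangentSpace (𝓡 3) x), 0 ≤ h.ricci x w w)
    (hF2 : NoncompactSpace N → (∀ x : N, 0 < h.scalarCurvature x) →
      ∃ (p : N) (w : TangentSpace (𝓡 3) p), w ≠ 0 ∧ h.ricci p w w = 0) :
    ((∀ x : N, h.scalarCurvature x = 0) ∧
        ∫⁻ x, ENNReal.ofReal (Real.exp (-φ x))
            ∂(riemannianMeasure (h.toContMDiffRiemannianMetric hh)) =
          ENNReal.ofReal (8 * Real.pi * Real.sqrt Real.pi)) ∨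
      (CompactSpace N ∧ (∀ x : N, h.scalarCurvature x = 3 / 2) ∧ (∀ x : N, φ x = 3 / 2) ∧
        ∃ k : ℕ, 0 < k ∧
          riemannianMeasure (h.toContMDiffRiemannianMetric hh) Set.univ =
            ENNReal.ofReal (16 * Real.pi ^ 2 / k)) ∨
      ((∀ x : N, h.scalarCurvature x = 1) ∧
        ∫⁻ x, ENNReal.ofReal (Real.exp (-φ x))
            ∂(riemannianMeasure (h.toContMDiffRiemannianMetric hh)) =
          ENNReal.ofReal (16 * Real.pi * Real.sqrt Real.pi * Real.exp (-1))) ∨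
      ((∀ x : N, h.scalarCurvature x = 1) ∧
        ∫⁻ x, ENNReal.ofReal (Real.exp (-φ x))
            ∂(riemannianMeasure (h.toContMDiffRiemannianMetric hh)) =
          ENNReal.ofReal (8 * Real.pi * Real.sqrt Real.pi * Real.exp (-1))) := by
  rcases scalarCurvature_pos_or_modelData_of_shrinkerScalarCurvature_nonneg
      shrinkerScalarCurvature_nonneg_holds N h φ hh hcpl hφ hsol hnorm with hSpos | hT
  · by_cases hc : CompactSpace N
    · exact modelData_of_compactSpace N h hh φ hφ hsol hnorm
    · haveI : NoncompactSpace N := not_compactSpace_iff.1 hc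
      have hRic0 := hF1 ‹NoncompactSpace N› hSpos
      obtain ⟨p, w, hw, hnull⟩ := hF2 ‹NoncompactSpace N› hSpos
      rcases DegenerateShrinker.modelData_of_degenerate h hh hφ hsol hnorm hcpl hRic0 hSpos hw hnull
        with hT | hT
      · exact Or.inr (Or.inr (Or.inl hT))
      · exact Or.inr (Or.inr (Or.inr hT))
  · exact hT

/-- **The named fact from the curvature inputs**: if (F1) and (F2) hold for every member of the
binder, `threeShrinkerClassification_modelData` follows. [cite: MunteanuWang2016, Thm. 1.2 (p. 3)]
[cite: Chen2009, Cor. 2.4] [cite: MunteanuWang2017, Thm. 2] -/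
theorem threeShrinkerClassification_modelData_of_curvature_inputs
    (hF1 : ∀ (N : Type) [TopologicalSpace N] [T2Space N] [SecondCountableTopology N]
      [ChartedSpace (EuclideanSpace ℝ (Fin 3)) N] [IsManifold (𝓡 3) ∞ N] [ConnectedSpace N]
      [T3Space N] [MeasurableSpace N] [BorelSpace N]
      (h : PseudoRiemannianMetric (𝓡 3) ∞ (EuclideanSpace ℝ (Fin 3))
        (TangentSpace (𝓡 3) : N → Type _)) [h.HasLeviCivita] (φ : N → ℝ) (hh : h.IsRiemannian),
      (∀ (x : N) (r : ℝ≥0), IsCompact {y : N | h.edist hh x y ≤ r}) →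
      ContMDiff (𝓡 3) 𝓘(ℝ, ℝ) ∞ φ →
      (∀ (x : N) (X Y : TangentSpace (𝓡 3) x),
        h.ricci x X Y + h.hessian φ x X Y = (1 / 2 : ℝ) * h.val x X Y) →
      (∀ x : N, h.scalarCurvature x + h.gradSq φ x = φ x) →
      NoncompactSpace N → (∀ x : N, 0 < h.scalarCurvature x) →
      ∀ (x : N) (w : TangentSpace (𝓡 3) x), 0 ≤ h.ricci x w w)
    (hF2 : ∀ (N : Type) [TopologicalSpace N] [T2Space N] [SecondCountableTopology N]
      [ChartedSpace (EuclideanSpace ℝ (Fin 3)) N] [IsManifold (𝓡 3) ∞ N] [ConnectedSpace N]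
      [T3Space N] [MeasurableSpace N] [BorelSpace N]
      (h : PseudoRiemannianMetric (𝓡 3) ∞ (EuclideanSpace ℝ (Fin 3))
        (TangentSpace (𝓡 3) : N → Type _)) [h.HasLeviCivita] (φ : N → ℝ) (hh : h.IsRiemannian),
      (∀ (x : N) (r : ℝ≥0), IsCompact {y : N | h.edist hh x y ≤ r}) →
      ContMDiff (𝓡 3) 𝓘(ℝ, ℝ) ∞ φ →
      (∀ (x : N) (X Y : TangentSpace (𝓡 3) x),
        h.ricci x X Y + h.hessian φ x X Y = (1 / 2 : ℝ) * h.val x X Y) →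
      (∀ x : N, h.scalarCurvature x + h.gradSq φ x = φ x) →
      NoncompactSpace N → (∀ x : N, 0 < h.scalarCurvature x) →
      ∃ (p : N) (w : TangentSpace (𝓡 3) p), w ≠ 0 ∧ h.ricci p w w = 0) :
    threeShrinkerClassification_modelData := by
  intro N _ _ _ _ _ _ _ _ _ h _ φ hh hcpl hφ hsol hnorm
  exact modelData_of_curvature_inputs N h φ hh hcpl hφ hsol hnorm
    (hF1 N h φ hh hcpl hφ hsol hnorm) (hF2 N h φ hh hcpl hφ hsol hnorm)

end ThreeShrinker

end Literature.Geometry.Riemannian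

end
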